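import Mathlib
import HarnessLib
import Literature.NumberTheory.LFunctions.RiemannXiFourier

/-!
# The odd twin of Plancherel for Riemann's kernel: `∫_ℝ t²|ξ(1/2 + it)|² dt = 16π ∫_ℝ Ψ′(u)² du`

Helper file (`--supports stmt-RiemannHypothesis-0098`), RH-free Fourier analysis, no definitions.  Seat
rh-explicit-weil-5 gen15 (file of record `HOME/rh-explicit-weil-5/WEIL5-KAPPA.md` §1; companion of
`Theorems/WeilRiemannKernelNormSq.lean`, which proves `∫_ℝ|ξ(1/2+it)|² = 4π∫_ℝΨ²`).

Context (documentation only).  The ODD class seed of the compressed Weil form transports to `−4κ_o(2π)^{1/4}Ψ′(u)`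
(`Theorems/WeilHermiteSeedOddRiemannKernel`), so its Gram norm is `8κ_o²√(2π)∫_ℝ(Ψ′)²`; on the critical line
`2·𝓕(Ψ′)(t/4π) = it·ξ(1/2+it)` (one derivative under Riemann's representation `ξ(1/2+it) = 𝓕Ψ(t/4π)`), and Plancherel for
`Ψ′` turns this into the odd Ξ-moment constant `(κ_o²/√(2π))∫_ℝt²|ξ(1/2+it)|²dt = 0.410296` of WEIL5-KAPPA §1.  The only new
analytic input beyond the tree's `RiemannXiFourier` is one more derivative: `Ψ‴` is odd and integrable, so
`|𝓕Ψ(w)| ≤ ‖Ψ‴‖₁/(2π|w|)³` and `w·𝓕Ψ(w)` — i.e. `𝓕Ψ′` — is integrable, which is what inversion needs.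

* `thetaSeries_δδδ_psiPoly_neg`, `integrable_deriv3_Psi` : `Ψ‴` is odd and integrable;
* `fourier_deriv_Psic`, `fourier_deriv3_Psic` : `𝓕Ψ′ = (2πiw)𝓕Ψ`, `𝓕Ψ‴ = (2πiw)³𝓕Ψ`;
* `norm_fourier_deriv_Psic_le`, `integrable_fourier_deriv_Psic` : `‖𝓕Ψ′(w)‖ ≤ C(1+w²)⁻¹`;
* `integral_norm_sq_fourier_deriv_Psic` : `∫‖𝓕Ψ′‖² = ∫(Ψ′)²` (Plancherel for `Ψ′`);
* `integral_sq_mul_norm_sq_riemannXi_criticalLine` : `∫_ℝ t²‖ξ(1/2+it)‖² dt = 16π∫_ℝ(Ψ′)²`.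

Standard axioms only; no `sorry`.
-/

set_option linter.dupNamespace false
set_option autoImplicit false

noncomputable section

open Real MeasureTheory Set Complex Polynomial
open scoped FourierTransform InnerProductSpace

namespace Summit.RiemannHypothesis.RiemannHypothesis.Theorems.WeilRiemannKernelDerivNormSq

open Literature.NumberTheory.LFunctions Literature.NumberTheory.LFunctions.LagariasMontague

/-! ## `Ψ‴`: odd, integrable -/

/-- `Ψ‴` is odd. -/
theorem thetaSeries_δδδ_psiPoly_neg (u : ℝ) :
    thetaSeries (thetaδ (thetaδ (thetaδ psiPoly))) (-u) = -thetaSeries (thetaδ (thetaδ (thetaδ psiPoly))) u := by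
  have hfun : (fun x => thetaSeries (thetaδ (thetaδ psiPoly)) (-x)) = fun x => thetaSeries (thetaδ (thetaδ psiPoly)) x :=
    funext thetaSeries_δδ_psiPoly_neg
  have := deriv_comp_neg (f := thetaSeries (thetaδ (thetaδ psiPoly))) (x := -u)
  rw [hfun, neg_neg, deriv_thetaSeries] at this
  linarith

/-- `Ψ‴` is integrable on `ℝ`. -/
theorem integrable_deriv3_Psi : Integrable (thetaSeries (thetaδ (thetaδ (thetaδ psiPoly)))) :=
  integrable_of_norm_neg (continuous_thetaSeries _) (integrableOn_thetaSeries _)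
    fun u => by rw [thetaSeries_δδδ_psiPoly_neg, norm_neg]

/-- `deriv (deriv (deriv Ψ)) = S_{δδδ(2X²−3X)}`. -/
theorem deriv3_Psic :
    deriv (deriv (deriv Psic)) = fun u => ((thetaSeries (thetaδ (thetaδ (thetaδ psiPoly))) u : ℝ) : ℂ) := by
  rw [deriv_deriv_Psic]
  funext u
  exact ((hasDerivAt_thetaSeries _ u).ofReal_comp).deriv

/-- `deriv (deriv Ψ)` is differentiable. -/
theorem differentiable_deriv_deriv_Psic : Differentiable ℝ (deriv (deriv Psic)) := by
  rw [deriv_deriv_Psic]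
  exact fun u => ((hasDerivAt_thetaSeries _ u).ofReal_comp).differentiableAt

/-- `deriv (deriv (deriv Ψ))` is integrable. -/
theorem integrable_deriv3_Psic : Integrable (deriv (deriv (deriv Psic))) := by
  rw [deriv3_Psic]
  exact integrable_deriv3_Psi.ofReal

/-! ## Fourier transforms of the derivatives and the decay of `𝓕Ψ′` -/

/-- `𝓕 Ψ′ (w) = (2πiw) 𝓕 Ψ (w)`. -/
theorem fourier_deriv_Psic (w : ℝ) : 𝓕 (deriv Psic) w = (2 * π * I * w) * 𝓕 Psic w := by
  rw [Real.fourier_deriv integrable_Psic differentiable_Psic integrable_deriv_Psic]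
  simp only [smul_eq_mul]

/-- `𝓕 Ψ‴ (w) = (2πiw)³ 𝓕 Ψ (w)`. -/
theorem fourier_deriv3_Psic (w : ℝ) :
    𝓕 (deriv (deriv (deriv Psic))) w = (2 * π * I * w) ^ 3 * 𝓕 Psic w := by
  rw [Real.fourier_deriv integrable_deriv_deriv_Psic differentiable_deriv_deriv_Psic integrable_deriv3_Psic]
  dsimp only
  rw [fourier_deriv_deriv_Psic]
  simp only [smul_eq_mul]
  ring

/-- `|w|³ ‖𝓕Ψ(w)‖ ≤ ‖Ψ‴‖₁/(2π)³`. -/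
theorem abs_pow_three_mul_norm_fourier_Psic_le (w : ℝ) :
    |w| ^ 3 * ‖𝓕 Psic w‖ ≤ (∫ u, ‖deriv (deriv (deriv Psic)) u‖) / (2 * π) ^ 3 := by
  have h3 : ‖𝓕 (deriv (deriv (deriv Psic))) w‖ ≤ ∫ u, ‖deriv (deriv (deriv Psic)) u‖ :=
    VectorFourier.norm_fourierIntegral_le_integral_norm _ _ _ _ _
  rw [fourier_deriv3_Psic] at h3
  simp only [norm_mul, norm_pow, Complex.norm_real, Complex.norm_I, mul_one, Complex.norm_ofNat,
    Real.norm_eq_abs, abs_of_pos pi_pos] at h3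
  rw [le_div_iff₀ (by positivity)]
  calc |w| ^ 3 * ‖𝓕 Psic w‖ * (2 * π) ^ 3 = (2 * π * |w|) ^ 3 * ‖𝓕 Psic w‖ := by ring
    _ ≤ ∫ u, ‖deriv (deriv (deriv Psic)) u‖ := h3

/-- `‖𝓕Ψ′(w)‖ ≤ C′(1 + w²)⁻¹` with `C′ := 4π(‖Ψ‖₁ + ‖Ψ‴‖₁/(2π)³)`. -/
theorem norm_fourier_deriv_Psic_le (w : ℝ) :
    ‖𝓕 (deriv Psic) w‖ ≤
      (4 * π * ((∫ u, ‖Psic u‖) + (∫ u, ‖deriv (deriv (deriv Psic)) u‖) / (2 * π) ^ 3)) * (1 + w ^ 2)⁻¹ := by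
  set A := ∫ u, ‖Psic u‖ with hA
  set B := (∫ u, ‖deriv (deriv (deriv Psic)) u‖) / (2 * π) ^ 3 with hB
  have hA0 : 0 ≤ A := integral_nonneg fun _ => norm_nonneg _
  have hB0 : 0 ≤ B := div_nonneg (integral_nonneg fun _ => norm_nonneg _) (by positivity)
  have h0 : ‖𝓕 Psic w‖ ≤ A := VectorFourier.norm_fourierIntegral_le_integral_norm _ _ _ _ _
  have h3 : |w| ^ 3 * ‖𝓕 Psic w‖ ≤ B := abs_pow_three_mul_norm_fourier_Psic_le w
  rw [fourier_deriv_Psic, norm_mul]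
  simp only [norm_mul, Complex.norm_real, Complex.norm_I, mul_one, Complex.norm_ofNat, Real.norm_eq_abs,
    abs_of_pos pi_pos]
  rw [le_mul_inv_iff₀ (by positivity)]
  -- goal: 2π|w|‖𝓕Ψ w‖ (1 + w²) ≤ 4π(A + B)
  have hn : 0 ≤ ‖𝓕 Psic w‖ := norm_nonneg _
  have hw : 0 ≤ |w| := abs_nonneg w
  -- |w| ‖F‖ ≤ A + B  (cases |w| ≤ 1, |w| ≥ 1) and |w|³‖F‖ ≤ B, so |w|(1+w²)‖F‖ ≤ A + 2B ≤ 2(A+B)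
  have h1 : |w| * ‖𝓕 Psic w‖ ≤ A + B := by
    rcases le_or_gt (|w|) 1 with hle | hgt
    · calc |w| * ‖𝓕 Psic w‖ ≤ 1 * ‖𝓕 Psic w‖ := by gcongr
        _ ≤ A + B := by linarith
    · have hw1 : 1 ≤ |w| ^ 2 := by nlinarith
      calc |w| * ‖𝓕 Psic w‖ ≤ |w| ^ 2 * (|w| * ‖𝓕 Psic w‖) := by nlinarith [mul_nonneg hw hn]
        _ = |w| ^ 3 * ‖𝓕 Psic w‖ := by ring
        _ ≤ A + B := by linarith
  have hsq : w ^ 2 = |w| ^ 2 := (sq_abs w).symm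
  calc 2 * π * |w| * ‖𝓕 Psic w‖ * (1 + w ^ 2)
      = 2 * π * (|w| * ‖𝓕 Psic w‖ + |w| ^ 3 * ‖𝓕 Psic w‖) := by rw [hsq]; ring
    _ ≤ 2 * π * ((A + B) + B) := by gcongr
    _ ≤ 4 * π * (A + B) := by nlinarith [pi_pos]

/-- `𝓕 Ψ′` is continuous. -/
theorem continuous_fourier_deriv_Psic : Continuous (𝓕 (deriv Psic)) :=
  VectorFourier.fourierIntegral_continuous Real.continuous_fourierChar (by exact continuous_inner)
    integrable_deriv_Psic

/-- `𝓕 Ψ′` is integrable. -/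
theorem integrable_fourier_deriv_Psic : Integrable (𝓕 (deriv Psic)) :=
  Integrable.mono' (integrable_inv_one_add_sq.const_mul _)
    continuous_fourier_deriv_Psic.aestronglyMeasurable (ae_of_all _ norm_fourier_deriv_Psic_le)

/-! ## Plancherel for `Ψ′` -/

/-- Self-adjointness + inversion for `Ψ′`: `∫ ⟪𝓕Ψ′, 𝓕Ψ′⟫ = ∫ ⟪Ψ′, Ψ′⟫`. -/
theorem integral_inner_fourier_deriv_Psic :
    ∫ ξ : ℝ, ⟪𝓕 (deriv Psic) ξ, 𝓕 (deriv Psic) ξ⟫_ℂ = ∫ x : ℝ, ⟪deriv Psic x, deriv Psic x⟫_ℂ := by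
  have key := VectorFourier.integral_sesq_fourierIntegral_eq_neg_flip (innerSL ℂ) (L := innerₗ ℝ)
    continuous_fourierChar continuous_inner integrable_deriv_Psic integrable_fourier_deriv_Psic
  simp only [flip_innerₗ, innerSL_apply_apply] at key
  have hinv : 𝓕⁻ (𝓕 (deriv Psic)) = deriv Psic :=
    differentiable_deriv_Psic.continuous.fourierInv_fourier_eq integrable_deriv_Psic integrable_fourier_deriv_Psic
  have key' : ∫ ξ : ℝ, ⟪𝓕 (deriv Psic) ξ, 𝓕 (deriv Psic) ξ⟫_ℂ =
      ∫ x : ℝ, ⟪deriv Psic x, 𝓕⁻ (𝓕 (deriv Psic)) x⟫_ℂ := key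
  rw [key', hinv]

/-- **Plancherel for `Ψ′`**: `∫_ℝ ‖𝓕Ψ′(w)‖² dw = ∫_ℝ Ψ′(u)² du` (`Ψ′ = S_{δ(2X²−3X)}`). -/
theorem integral_norm_sq_fourier_deriv_Psic :
    ∫ w : ℝ, ‖𝓕 (deriv Psic) w‖ ^ 2 = ∫ u : ℝ, (thetaSeries (thetaδ psiPoly) u) ^ 2 := by
  have h := integral_inner_fourier_deriv_Psic
  simp only [inner_self_eq_norm_sq_to_K] at h
  have h1 : ∫ ξ : ℝ, ((‖𝓕 (deriv Psic) ξ‖ : ℂ)) ^ 2 = ((∫ ξ : ℝ, ‖𝓕 (deriv Psic) ξ‖ ^ 2 : ℝ) : ℂ) := by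
    rw [← integral_complex_ofReal]
    congr 1
    funext ξ
    push_cast
    rfl
  have h2 : ∫ x : ℝ, ((‖deriv Psic x‖ : ℂ)) ^ 2 = ((∫ x : ℝ, ‖deriv Psic x‖ ^ 2 : ℝ) : ℂ) := by
    rw [← integral_complex_ofReal]
    congr 1
    funext x
    push_cast
    rfl
  have h3 : ∫ w : ℝ, ‖𝓕 (deriv Psic) w‖ ^ 2 = ∫ x : ℝ, ‖deriv Psic x‖ ^ 2 :=
    Complex.ofReal_injective (h1.symm.trans (h.trans h2))
  rw [h3, deriv_Psic]
  refine integral_congr_ae (ae_of_all _ fun x => ?_)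
  simp only [Complex.norm_real, Real.norm_eq_abs, sq_abs]

/-- **`∫_ℝ t²|ξ(1/2 + it)|² dt = 16π ∫_ℝ Ψ′(u)² du`** — the odd Ξ-moment is the `L²` norm of `Ψ′`
(`2𝓕Ψ′(t/4π) = it·ξ(1/2+it)` and Plancherel).  Numerically `∫_ℝ t²Ξ² = 20.507`; in the transport normalisation this is
the odd Gram constant `(κ_o²/√(2π))∫t²Ξ² = 8κ_o²√(2π)∫(Ψ′)² = 0.410296` of WEIL5-KAPPA §1. -/
theorem integral_sq_mul_norm_sq_riemannXi_criticalLine :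
    ∫ t : ℝ, t ^ 2 * ‖riemannXi (1 / 2 + t * I)‖ ^ 2 = 16 * π * ∫ u : ℝ, (thetaSeries (thetaδ psiPoly) u) ^ 2 := by
  have hpt : ∀ t : ℝ, t ^ 2 * ‖riemannXi (1 / 2 + t * I)‖ ^ 2 = 4 * ‖𝓕 (deriv Psic) (t / (4 * π))‖ ^ 2 := by
    intro t
    rw [riemannXi_criticalLine_eq_fourier, fourier_deriv_Psic, norm_mul]
    simp only [norm_mul, Complex.norm_real, Complex.norm_I, mul_one, Complex.norm_ofNat, Real.norm_eq_abs,
      abs_of_pos pi_pos]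
    rw [mul_pow, show (2 * π * |t / (4 * π)|) = |t| / 2 by
      rw [abs_div, abs_of_pos (by positivity : (0:ℝ) < 4 * π)]; field_simp; ring]
    rw [div_pow, sq_abs]
    ring
  simp_rw [hpt]
  rw [integral_const_mul, Measure.integral_comp_div (fun w => ‖𝓕 (deriv Psic) w‖ ^ 2),
    integral_norm_sq_fourier_deriv_Psic, abs_of_pos (by positivity), smul_eq_mul]
  ring

end Summit.RiemannHypothesis.RiemannHypothesis.Theorems.WeilRiemannKernelDerivNormSq

end
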